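import Mathlib.NumberTheory.LocalField.Basic
import Mathlib.FieldTheory.Finite.Basic
import Mathlib.RepresentationTheory.Intertwining
import Mathlib.Algebra.CharP.Defs
import Mathlib.FieldTheory.IsAlgClosed.Basic
import Mathlib.Data.ZMod.Basic
import Literature.NumberTheory.Automorphic.SmoothInduction
import Literature.NumberTheory.Automorphic.ParabolicGL
import HarnessLib

/-!
# Barrier (Langlands, `GL_n` reciprocity): the mod `p` / `p`-adic local Langlands correspondence does not extend naively beyond `GL₂(ℚ_p)`

Barrier catalogue entry (D-0021) for the summit `Langlands`, on the "`ℓ = p`" side of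
automorphy lifting.  Kisin's proof of (most of) the Fontaine–Mazur conjecture for `GL₂` over `ℚ` in
arbitrary regular weight reduces the modularity lifting theorem to the Breuil–Mézard equality and
proves the hard inequality with the `p`-adic local Langlands correspondence for `GL₂(ℚ_p)`
(Colmez's functor); as printed, the argument covers "any totally real field in which `p` splits
completely".  The sources below print why the same route is not available at a place `v ∣ p` with
`F_v ≠ ℚ_p` (or for `GL_n`, `n ≥ 3`): the mod `p` representation theory of `GL₂(F)`, `F ≠ ℚ_p`,
has "far more numerous" irreducible objects than the Galois side, so that "there is no possible
naive `1 − 1` correspondence as for the `F = ℚ_p` case", and no local correspondence is known.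
This file vendors the printed abundance theorem as a NAMED FACT (statement only; it is a theorem
in print, out of reach of the tree's current smooth-representation library) with the BARRIER block.

**AUDIT (provefact, 2026-08-15): `ModPLanglandsGL2BeyondQp` is MIS-STATED (coefficient
convention) and is not to be discharged.**  It asks for irreducibility over a FINITE field `k`
and tests only `k`-valued principal series, whereas the sources mean absolutely irreducible
representations (Breuil, §1 p. 206) over `𝔽̄_p` (Breuil–Paškūnas, §1 p. 12); as written its
conclusion is met for every `F`, `ℚ_p` included, by restrictions of scalars of principal series
(see the section "Audit of the coefficient convention" below, which gives the witness and the
sources).  The body is kept verbatim (D-0014: never edited in place; no importers); the faithful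
statements are `ModPLanglandsGL2BeyondQpFpBar` (the survey claim, coefficients `𝔽̄_p`) and
`BreuilPaskunas2012_supersingularFamily` (the case proved in print), below.  Since 2026-08-15 the
mis-stated original is `@[deprecated ModPLanglandsGL2BeyondQpFpBar]` and stands LAST in the file
(after the corrected statements), kept for the record only.  **Verdict clean-up (defact seat,
2026-08-15):** the verdict was re-verified with the sources open (survey pp. 204, 206 and 218;
memoir §1 pp. 3 and 12; Mathlib's `Representation.IsIrreducible` is
`IsSimpleOrder (Subrepresentation ρ)`, irreducibility over the coefficient field itself) and
confirmed: MIS-STATED, corrected under the new name `ModPLanglandsGL2BeyondQpFpBar` (the change of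
coefficient field is not meaning-preserving, so the old name is not reused).  The original keeps
its name, its body byte for byte and its `deprecated` tag (which now also states the reason), but
its docstring is rewritten in the tombstone form (printed text, what is wrong, corrected
statements, one citation tag marked "as mis-rendered") and no longer repeats the structured
D-0021 block: the barrier catalogue is parsed from the docstring of every declaration in this
directory, so the catalogued entries of this file are now exactly the two live statements, and
routes and idea cards address `ModPLanglandsGL2BeyondQpFpBar` /
`BreuilPaskunas2012_supersingularFamily`, not the tombstone.

**REVIEW (D-0026 bad-split review, 2026-08-15): `ModPLanglandsGL2BeyondQpFpBar` is NOT a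
decomposition child; it is the corrected barrier statement itself (the apex), SIZE XL, and is to
stay a named fact (D-0021) — do not seat it for an inline proof or a further split.**  Its
prove-seat's XL triage is confirmed: a Lean proof needs the mod `p` smooth representation theory of
`GL₂(F)` (compact induction `c-Ind_{KZ}^G σ` and the Hecke operator `T`, Barthel–Livné's
classification, Paškūnas' coefficient systems / diagrams on the tree and `H₀(D)`, injective
envelopes in `Rep_K` and `Rep_I` and Breuil–Paškūnas' Thm. 9.8, the modular representation theory
of `GL₂(𝔽_q)`), none of which is in Mathlib or this tree; only the one-page irreducibility
criterion (memoir Thm. 1.2 (ii)) is proved in the tree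
(`Literature.NumberTheory.Automorphic.BreuilPaskunas2012_basicDiagramIrreducible_holds`, file
`ModPDiagramsGL2`).  Map of PRINTED proofs of the statement as quantified (all primes `p`, all
`F/ℚ_p` with `#k_F > p`, i.e. `f ≥ 2`), established at the review with the sources open:
`p > 3`, every such `F`, ramified or not — Sheth, Pacific J. Math. 321 (2022), §3 Thm. 3.2 and
Cor. 3.3: "the universal supersingular modules of `GL₂(F)` admit
infinitely many non-isomorphic irreducible admissible quotients", "a new result … for `F`
ramified over `ℚ_p`" [cite: Sheth2022, Thm. 3.2 and Cor. 3.3]; `p > 2`, `F` unramified —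
Breuil–Paškūnas (`BreuilPaskunas2012_supersingularFamily` below)
[cite: BreuilPaskunas2012, Thm. 19.8 and Thm. 19.10]; `p = 2` (any `F` with `f ≥ 2`) and `p = 3`
with `F` ramified — NO printed proof located: there the statement rests on the survey sentence
alone [cite: Breuil2011, §3.2] (Sheth's cyclic modules need a weight with `1 ≤ r_i ≤ p - 3`,
i.e. `p ≥ 5` [cite: Sheth2022, Thm. 1.6]; the memoir's generic `ρ̄` need `p ≥ 3` and `F = ℚ_{p^f}`
[cite: BreuilPaskunas2012, §1]).  The statement is kept as printed in the survey (two reviews,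
p21713/p22728, found it faithful); the uncovered corner is recorded in its `scope_caveats:` line.
(Gen-1 provefact seat, 2026-08-15, sources re-read — survey pp. 204–206 and 216–218, memoir §§1,
9–11, 13, 19, Sheth's paper in full: concurs with the XL triage and the map above, attempts no
discharge, and corrects the Sheth locators of this file to the numbering PRINTED in
arXiv:2210.07283v1 = Pacific J. Math. 321 — §1 Def. 1.1–Rem. 1.9 with Thm. 1.6 (cyclic modules
exist), §2 Def. 2.1 (cyclic diagrams) and Lemma 2.2, §3 Thm. 3.1 (= memoir Thm. 9.8 with
Thm. 1.2 (ii)), Thm. 3.2 (main theorem), Cor. 3.3, Rem. 3.4; the flat numbers "Thm. 4, Thm. 10,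
Thm. 11, Cor. 12" previously written here are artefacts of a text extraction, not printed
anywhere.)

## What the sources print

* Breuil, *The emerging `p`-adic Langlands programme*, Proc. ICM 2010, Vol. II, 203–230.
  §1 (p. 204): for `F ≠ ℚ_p` "the complications on the `GL₂` side are roughly twofold: (i) there
  are infinitely many smooth irreducible (admissible) representations of `GL₂(F)` over any finite
  field containing the residue field of `F` (whereas when `F = ℚ_p` there is only a finite number
  of them) and (ii) the vast majority of them are much harder to study than for `F = ℚ_p`.  In
  particular (i) has the consequence that there is no possible naive `1 − 1` correspondence as
  for the `F = ℚ_p` case"; p. 205: "almost everything is known for `GL₂(ℚ_p)` but most of the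
  experts (including the author) are quite puzzled by the apparent complexity of whatever seems to
  happen for any other group."  §2.1: for `F = ℚ_p` the representations
  `π(σ, 0) := c-Ind_{GL₂(ℤ_p)ℚ_p^×}^{GL₂(ℚ_p)} σ/(T)` "are irreducible and admissible" and "form the
  so-called supersingular representations", and together with the Jordan–Hölder factors of the
  principal series `Ind_B χ₁ ⊗ χ₂` exhaust the smooth irreducible representations with a central
  character.  §3.1, Thm. 3.3: "Assume `F ≠ ℚ_p`.  For any Serre weight `σ` the representation
  `π(σ, 0)` is of infinite length and is not admissible."  §3.2 (p. 218), from Thm. 3.4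
  (= Breuil–Paškūnas, §9): "These examples are enough to show that there are infinitely many
  irreducible admissible non-isomorphic quotients of the representations `π(σ, 0)`, for instance
  because there are infinitely many `D₀` containing `σ` for which there exist many non-isomorphic
  compatible actions of `N(F)` on `D₀^{I₁}` such that any `π` as in Theorem 3.4 is irreducible and
  is not a subquotient of a principal series (see [16] when `k_F` is not `F_p`)"; "The
  classification of all irreducible representations of `GL₂(F)` over `k_E` with a central character
  remains thus unsettled."  §3.4, Thm. 3.12 (Paškūnas): every smooth irreducible admissible `π`
  over `k_E` is the reduction of a unit ball in an admissible unitary topologically irreducible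
  Banach representation over `E`, so "one also has too many" Banach representations for `F ≠ ℚ_p`.
* Kisin, *The Fontaine–Mazur conjecture for `GL₂`*, J. Amer. Math. Soc. 22 (2009), Introduction
  (pp. 641–643): "establishing a modularity lifting theorem was essentially equivalent to proving
  the reverse [Breuil–Mézard] inequality … The tool which enables us to prove the reverse inequality
  is the `p`-adic local Langlands correspondence" for `GL₂(ℚ_p)`; "we prove the theorem in somewhat
  greater generality, where `ℚ` is replaced by any totally real field in which `p` splits
  completely."
* Caraiani–Emerton–Gee–Geraghty–Paškūnas–Shin, *Patching and the `p`-adic local Langlands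
  correspondence*, Camb. J. Math. 4 (2016), §1: "At present, the existence of such a
  correspondence is only known for `GL₁(F)` … and for `GL₂(ℚ_p)`"; they construct by
  Taylor–Wiles–Kisin patching "a candidate for the `p`-adic local Langlands correspondence for
  `GL_n(F)`" but "do not prove that our construction gives a purely local correspondence (and it
  would perhaps be premature to conjecture that it should)".
* Sheth, *On irreducible supersingular representations of `GL₂(F)`*, Pacific J. Math. 321 (2022)
  (standing assumption `p > 3`: "Let `p > 3` be a prime number. Let `F` be a non-archimedean local
  field of residual characteristic `p` and residue degree `f`", Notation and convention), Thm. 3.2: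
  "Let `F` be a non-archimedean local field of residue
  degree `f > 1`.  Then the group `G` admits infinitely many non-isomorphic smooth admissible
  irreducible supersingular representations on which `ϖ` acts trivially.  Further, all these
  representations have the same `K`-socle."  Cor. 3.3: "Then the universal supersingular module
  `π(σ, 0, χ)` of `G` has infinitely many non-isomorphic admissible irreducible quotients for
  any given weight `σ = r ⊗ η` with `1 ≤ r₀, …, r_{f-1} ≤ p - 3` and any smooth character `χ`."
  §1: "While Corollary 3.3 follows from the main results of [3] for `F = ℚ_{p^f}`, it is a new
  result, to our knowledge, for `F` ramified over `ℚ_p` and for `F` of positive characteristic"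
  ([3] = Breuil–Paškūnas).  Ingredients: Thm. 1.6 ("The group `Γ` admits a multiplicity-free
  cyclic module `D₀`", from weights `r` with `1 ≤ r_i ≤ p - 3`), Def. 2.1 and Lemma 2.2 (cyclic
  diagrams are irreducible basic `0`-diagrams, classified up to isomorphism by
  `t = t₁ ⋯ t_n ∈ 𝔽̄_p^×`), Thm. 3.1 (= memoir Thm. 9.8 together with the irreducibility
  criterion Thm. 1.2 (ii)).

## What this file states (named facts, D-0014 form)

Three `Prop`s: `ModPLanglandsGL2BeyondQpFpBar` (the survey claim of Breuil 2010 §3.2 with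
coefficients an algebraic closure of `𝔽_p`: asserted in print for all `F` with `#k_F > p`),
`BreuilPaskunas2012_supersingularFamily` (proved in print: `p > 2`, `F` unramified over `ℚ_p`,
`f ≥ 2`) with the specialisation `BreuilPaskunas2012_supersingularFamily.of_fpBar`, and — last and
`@[deprecated]` — `ModPLanglandsGL2BeyondQp` (the original rendering — MIS-STATED, superseded, kept
verbatim per the provefact protocol).  In detail:

`ModPLanglandsGL2BeyondQp`: for a prime `p`, a non-archimedean local field `F` of characteristic `0`
whose residue field `k_F` has characteristic `p` and more than `p` elements (so `F` is a finite
extension of `ℚ_p` with `k_F ≠ 𝔽_p`), and every sufficiently large finite field `k` of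
characteristic `p`, there is a sequence `(π_i)_{i ∈ ℕ}` of admissible (hence smooth: the tree's
`IsAdmissible` includes `IsSmooth`), irreducible `k`-representations of `GL₂(F)`, pairwise non-
isomorphic, with a common central character, none of which is a subquotient of a principal series
`Ind_{B(F)}^{GL₂(F)} χ`
(Breuil 2010, §3.2, reporting Breuil–Paškūnas §9).  Carriers: Mathlib's
`IsNonarchimedeanLocalField`, `Representation`, `Representation.Equiv`,
`Representation.IntertwiningMap`, `Subrepresentation`; the tree's `Representation.IsSmooth`,
`Representation.IsAdmissible`, `Representation.HasCentralCharacter`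
(`Literature/NumberTheory/Automorphic/SmoothRepresentation`), smooth induction
`Representation.smoothIndRep` (`SmoothInduction`) and the Borel `Literature.standardParabolicGL F id`
(`ParabolicGL`).

## References

* [Bre2011] C. Breuil, Proc. ICM 2010 Vol. II (2011) 203–230, §1, §2.1, §3.1 Thm. 3.3, §3.2
  Thm. 3.4, §3.4 Thm. 3.12. [cite: Breuil2011, §1 and §3]
* [BP2012] C. Breuil, V. Paškūnas, Mem. AMS 216 (2012) no. 1016, §9 (as reported in [Bre2011,
  Thm. 3.4]). [cite: BreuilPaskunas2012, §9]
* [Kis2009] M. Kisin, J. Amer. Math. Soc. 22 (2009) 641–690, Introduction. [cite: Kisin2009, Introduction]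
* [CEGGPS2016] A. Caraiani, M. Emerton, T. Gee, D. Geraghty, V. Paškūnas, S. W. Shin, Camb. J.
  Math. 4 (2016) 197–287, §1, Thm. 2, Thm. 3. [cite: CaraianiEtAl2016, §1]
* [ACC+2023] P. Allen et al., Ann. of Math. 197 (2023) 897–1113, §1. [cite: ACCGHLNSTT2023, §1]
* [CG2018] F. Calegari, D. Geraghty, Invent. Math. 211 (2018), §1. [cite: CalegariGeraghty2017, §1]
* [AHHV2017] N. Abe, G. Henniart, F. Herzig, M.-F. Vignéras, J. Amer. Math. Soc. 30 (2017)
  495–559, §I.3 Thms. 1–3, §I.5 Thm. 5 (used in the audit section below). [cite: AbeEtAl2016, Thms. 1–3 and Thm. 5]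
* [Sch2022] M. M. Schein, Israel J. Math. 255 (2022) 911–930, Thm. 1.1 (audit section below).
  [cite: Schein2022, Thm. 1.1]
* [Pas2004] V. Paškūnas, Mém. SMF 99 (2004), Introduction and Thm. 6.25 (at least `q(q-1)/2`
  supersingular representations for arbitrary `F`). [cite: Paskunas2004, Thm. 6.25]
* [She2022] M. Sheth, Pacific J. Math. 321 (2022) 431–442 = arXiv:2210.07283v1 (same numbering:
  §1 Thm. 1.6, §2 Def. 2.1 and Lemma 2.2, §3 Thm. 3.1 = [BP2012, Thm. 9.8 + Thm. 1.2 (ii)],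
  Thm. 3.2, Cor. 3.3); standing assumption `p > 3`; `F` any non-archimedean local field of residue
  characteristic `p` and residue degree `f > 1` (bad-split review, 2026-08-15; locators corrected
  to the printed numbering by the gen-1 provefact seat, 2026-08-15). [cite: Sheth2022, Thm. 3.2 and Cor. 3.3]
-/

open scoped ValuativeRel

namespace Literature.Barriers.Langlands

/-! ## Principal series of `GL₂(F)` and their subquotients -/

section PrincipalSeries

variable (F : Type) [Field F] [ValuativeRel F] [TopologicalSpace F] [IsNonarchimedeanLocalField F]

/-- The upper-triangular Borel subgroup `B(F) ≤ GL₂(F)` (the tree's standard parabolic for the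
identity block labelling of `Fin 2`). [folklore] -/
abbrev borelGL2 : Subgroup (GL (Fin 2) F) := Literature.NumberTheory.Automorphic.standardParabolicGL F (id : Fin 2 → Fin 2)

variable {F}
variable {k : Type} [Field k]

/-- `π` is a **subquotient of a principal series** of `GL₂(F)` over `k`: for some smooth character
`χ : B(F) → k^×` (a smooth representation of `B(F)` on the line `k`, e.g. `χ₁ ⊗ χ₂`) there are a
subrepresentation `W` of the smooth induction `Ind_{B(F)}^{GL₂(F)} χ`
(`Representation.smoothIndRep`, locally constant functions) and a surjective intertwining map
`W ↠ π` — i.e. `π ≅ W/W'` for `G`-stable `W' ≤ W ≤ Ind χ`.  Irreducible admissible `π` with a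
central character that are *not* of this form are Barthel–Livné's **supersingular**
representations (Breuil 2010, §2.1, §3.2). [cite: Breuil2011, §2.1] -/
def IsSubquotientOfPrincipalSeries {V : Type} [AddCommGroup V] [Module k V]
    (π : Representation k (GL (Fin 2) F) V) : Prop :=
  ∃ (χ : Representation k (borelGL2 F) k) (_ : χ.IsSmooth)
    (W : Subrepresentation (Representation.smoothIndRep (borelGL2 F) χ))
    (f : Representation.IntertwiningMap W.toRepresentation π), Function.Surjective f

end PrincipalSeries


/-! ## Audit of the coefficient convention (provefact pass, 2026-08-15)

Reading the sources against the named fact `ModPLanglandsGL2BeyondQp` (the original rendering, now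
last in this file) shows that its *conclusion* does not formalise
what Breuil prints, because the coefficient convention of the survey was dropped:

* Breuil, §1 (p. 206): "Representations always take values … in `k_E`-vector spaces where `E`
  is always a 'sufficiently big' finite extension of `ℚ_p` … For instance irreducible always
  means absolutely irreducible". [cite: Breuil2011, §1]
* Breuil, §1 (p. 204): "(i) there are infinitely many smooth irreducible (admissible)
  representations of `GL₂(F)` over any finite field containing the residue field of `F` (whereas
  when `F = ℚ_p` there is only a finite number of them)". [cite: Breuil2011, §1]

`ModPLanglandsGL2BeyondQp` asks for `Representation.IsIrreducible` over the finite field `k`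
itself (not absolute irreducibility), and `IsSubquotientOfPrincipalSeries` only tests principal
series `Ind_{B(F)}^{GL₂(F)} χ` with `χ` valued in `k`.  With these two readings the conclusion is
met, for EVERY non-archimedean local field `F` — including `F = ℚ_p`, where Breuil prints that
there are only finitely many — and every finite `k`, by representations having nothing to do with
supersingular ones: for `k'/k` of degree `d ≥ 2` and an unramified character `χ : F^× → k'^×`
with `k(χ(ϖ)) = k'`, `χ² ≠ 1`, the restriction of scalars `Res_{k'/k} Ind_{B(F)}^{GL₂(F)}(χ ⊗ χ⁻¹)`
is smooth, admissible, irreducible over `k` (its base change to `k'` is the direct sum of the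
`d` Galois conjugates `Ind(χ^σ ⊗ χ^{-σ})`, `σ ∈ Gal(k'/k)`, pairwise non-isomorphic and each
absolutely irreducible since `χ^σ ≠ χ^{-σ}`, and `Gal(k'/k)` permutes them transitively, so a
`k`-subrepresentation is `0` or everything), has trivial central character, has a `d`-dimensional
space of
`GL₂(𝒪_F)`-invariants (so different `d` give non-isomorphic representations), and is not a
subquotient of any `Ind_{B(F)} χ₀` with `χ₀` `k`-valued (the Jordan–Hölder factors of
`Ind χ₀ ⊗_k k̄` are `Ind χ₀` itself, or a character and a twist of the Steinberg representation,
and `Ind(χ ⊗ χ⁻¹) ≅ Ind χ₀` forces `χ₀ = χ ⊗ χ⁻¹`, which is not `k`-valued).  The facts about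
principal series over `k̄` used here — `Ind_B(χ₁ ⊗ χ₂)` is irreducible for `χ₁ ≠ χ₂`;
`Ind_B(ψ ⊗ ψ)` has the two irreducible factors `ψ ∘ det` and `St ⊗ ψ ∘ det`; `Ind_B χ ≅ Ind_B χ'`
only for `χ = χ'`, and an irreducible `Ind_B χ` is not isomorphic to a twist of `St` — are the
case `G = GL₂`, `P = B` of the classification of Abe–Henniart–Herzig–Vignéras by supercuspidal
triples `(P, σ, Q)` (here `I(B, χ, B) = Ind_B χ` for `χ₁ ≠ χ₂`, `I(B, ψ ⊗ ψ, B) = St ⊗ ψ ∘ det`,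
`I(B, ψ ⊗ ψ, G) = ψ ∘ det`) [cite: AbeEtAl2016, Thms. 1–3], for `GL₂`
"obtained … in the pioneering work of L. Barthel and R. Livné" (loc. cit., §I.2); for `F = ℚ_p`
they are restated in [cite: Breuil2011, §2.1].  Hence `ModPLanglandsGL2BeyondQp` is MIS-STATED:
its conclusion holds (given these classification results) for reasons orthogonal to the barrier,
and in particular does not separate `F = ℚ_p` from `F ≠ ℚ_p`.

The corrected statements below put the coefficients where the primary source puts them —
Breuil–Paškūnas work throughout over `𝔽̄_p` ("All representations are over `𝔽̄_p`-vector
spaces", §1 p. 12) [cite: BreuilPaskunas2012, §1] — so that irreducible = absolutely irreducible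
and every smooth character of `B(F)` is available to `IsSubquotientOfPrincipalSeries`; over an
algebraically closed field the irreducible admissible representations of the torus are the smooth
characters (Schur's lemma on the finite-dimensional spaces of `K`-invariants), so for an
irreducible admissible `π` — all Borel subgroups of `GL₂(F)` being conjugate to `B(F)` —
"`¬ IsSubquotientOfPrincipalSeries π`" is then the condition "supercuspidal" of
Abe–Henniart–Herzig–Vignéras (irreducible admissible, not a subquotient of `Ind_P^G σ` for a
proper parabolic `P` and an irreducible admissible `σ` of its Levi quotient), which for
irreducible admissible `π` is equivalent to "supersingular" [cite: AbeEtAl2016, Thm. 5]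
("For `G = GL₂` this was discovered by Barthel and Livné").

Two statements are vendored:

* `ModPLanglandsGL2BeyondQpFpBar` — the survey claim of [cite: Breuil2011, §3.2] with the same
  scope as the original (`char F = 0`, residue characteristic `p`, `#k_F > p`) but over an algebraic
  closure of `𝔽_p`.  Status: ASSERTED in print for all such `F` (Breuil, §3.2: "there are
  infinitely many irreducible admissible non-isomorphic quotients of the representations
  `π(σ, 0)` … (see [16] when `k_F` is not `𝔽_p`)"); PROVED in print for `F` unramified over
  `ℚ_p` and `p > 2` (next item) and — located at the bad-split review, 2026-08-15 — for EVERY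
  non-archimedean local field `F` of residue characteristic `p > 3` and residue degree `f > 1`,
  ramified or not (indeed of either characteristic), by Sheth [cite: Sheth2022, Thm. 3.2 and Cor. 3.3]:
  from Breuil–Paškūnas' Thm. 9.8 and the irreducibility criterion Thm. 1.2 (ii) applied to
  irreducible "cyclic" basic `0`-diagrams `D(t)`, `t ∈ 𝔽̄_p^×`, on one multiplicity-free cyclic
  `GL₂(𝔽_q)`-module `D₀` (which exists for `p > 3`, Thm. 1.6: weights `r` with
  `1 ≤ r_i ≤ p - 3`), Sheth obtains pairwise non-isomorphic smooth admissible irreducible `π(t)`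
  with `ϖ` acting trivially and the same `K`-socle (Thm. 3.2), supersingular because
  `dim π(t)^{I₁} ≥ dim D₀^{I₁} ≥ 4 > 2` rules out `λ ≠ 0` in Barthel–Livné's `π(σ, λ, χ) ↠ π(t)`,
  hence (Cor. 3.3) "the universal supersingular module `π(σ, 0, χ)` of `G` has infinitely many
  non-isomorphic admissible irreducible quotients for any given weight `σ = r ⊗ η` with
  `1 ≤ r₀, …, r_{f-1} ≤ p - 3` and any smooth character `χ`" — quotients of one `π(σ, 0, χ)`
  share its central character, and supersingular = not a subquotient of a principal series
  [cite: AbeEtAl2016, Thm. 5]; "While Corollary 3.3 follows from the main results of [3] for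
  `F = ℚ_{p^f}`, it is a new result, to our knowledge, for `F` ramified over `ℚ_p` and for `F`
  of positive characteristic" (loc. cit., §1).  What remains WITHOUT a printed proof is the
  corner `p = 2` (all `F` with `f ≥ 2`) and `p = 3` with `F` ramified, where the statement rests
  on the survey sentence alone.  Earlier partial results for ramified `F`: the memoir's own
  irreducibility argument is not available ("This uses computations with Witt vectors and we
  suspect that the argument here breaks down when `F` is ramified over `ℚ_p`",
  [cite: BreuilPaskunas2012, §1] p. 9); irreducible supersingular families with the `K`-socle
  predicted by Serre's conjecture for ramified `F` with `k_F = 𝔽_{p²}` and `e ≤ (p-1)/2` were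
  constructed in [cite: Schein2022, Thm. 1.1]; and the growing-socle family of
  [cite: BreuilPaskunas2012, §10] (p. 64, `F = ℚ_{p²}`) rests on Prop. 10.2, printed without proof
  ("we don't give details here, as we don't use it in the paper").
* `BreuilPaskunas2012_supersingularFamily` — what the memoir proves: for `p > 2` and `F` the
  unramified extension of `ℚ_p` of degree `f ≥ 2`, there are infinitely many pairwise
  non-isomorphic smooth admissible irreducible supersingular `𝔽̄_p`-representations of `GL₂(F)`
  with a common central character.  Chain of printed results: generic irreducible
  `ρ : Gal(ℚ̄_p/ℚ_{p^f}) → GL₂(𝔽̄_p)` exist for every `p ≥ 3` (Def. 11.7 and the remark after it: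
  "there is no such `ρ` for `p = 2` and … for `p = 3` the only possibility is `ρ` irreducible
  with `r₀ = 1` and `r_i = 0` for `i > 0`"); to such `ρ` (twisted so that `p` acts trivially on
  `det ρ`) §13 attaches the family of basic `0`-diagrams `D(ρ, r) = (D₀(ρ), D₁(ρ), r)`, and
  "When `f > 1`, this family is always infinite" (§13, p. 75; Introduction p. 7: "Up to
  isomorphisms of commutative diagrams, it turns out there are infinitely many such injections as
  soon as `f > 1`"); Thm. 19.8 (i): for each `D(ρ, r)` there is a smooth admissible `π` with
  `soc_K π = ⊕_{σ ∈ 𝒟(ρ)} σ`, `(π^{K₁}, π^{I₁}, can) ⊇ D(ρ, r)`, generated by `D₀(ρ)`; Thm. 19.8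
  (ii): non-isomorphic `D(ρ, r)`, `D(ρ, r')` give non-isomorphic `π`, `π'`; Thm. 19.10 (i): for
  `ρ` irreducible "any `π` satisfying (a), (b), (c) of (i) of Theorem 19.8 is irreducible and is
  a supersingular representation"; all these `π` have "fixed central character (matching
  `det(ρ)` via local class field theory)" (§1, p. 3; `p` acts trivially, §13 p. 78).
  [cite: BreuilPaskunas2012, Thm. 19.8 and Thm. 19.10]

(Page references to the memoir follow the authors' preprint version, `supersingular.pdf` on
Breuil's publication page, 122 pp.; its section, definition and theorem numbering — Def. 9.1,
Thm. 9.8, Def. 11.7, Def. 13.7, Thm. 13.8, Thms. 19.8–19.10 — is the one used by the citing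
literature, e.g. [cite: Schein2022, §1.4].  Page references to Breuil's survey are those of the
published ICM volume, pp. 203–230.)

`BreuilPaskunas2012_supersingularFamily.of_fpBar` records that the second is the special case of
the first in which a complete proof is printed (for `p > 3` the first is Sheth's theorem, see
above; the two printed proofs together cover every `(p, F)` in the first's range except `p = 2`,
and `p = 3` with `F` ramified).  Neither statement is proved here: the printed
proof is the whole memoir (§§2–5 modular representation theory of `GL₂(𝔽_q)` and injective
envelopes, §9 diagrams and Thm. 9.8, §§11–15 Diamond diagrams, §§17–19 the representations
`R(σ)` and the extension lemma) on top of Barthel–Livné and Paškūnas' coefficient systems — and,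
for Sheth's route, still Thm. 9.8, Barthel–Livné and the `GL₂(𝔽_q)`-extensions of weights of
§§2–5 — none of which exists in Mathlib or in this tree (SIZE XL in the provefact census,
confirmed at the bad-split review of 2026-08-15: both are apex statements, not decomposition
children; keep as named facts).
-/

section Corrected

/-- **Corrected form of `ModPLanglandsGL2BeyondQp`: coefficients in `𝔽̄_p`.**  For a prime `p`, a
non-archimedean local field `F` of characteristic `0` whose residue field has characteristic `p`
and more than `p` elements (so `F/ℚ_p` is finite and `k_F ≠ 𝔽_p`), and an algebraic closure `k`
of `𝔽_p` (`IsAlgClosure (ZMod p) k`), there is a sequence of smooth admissible irreducible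
`k`-representations of `GL₂(F)`, pairwise non-isomorphic, with a common central character, none
of which is a subquotient of a principal series `Ind_{B(F)}^{GL₂(F)} χ` (`χ` any smooth
`k`-valued character of `B(F)`), i.e. all supersingular.  This is the statement printed in
Breuil's ICM survey, §3.2 p. 218 ("These examples are enough to show that there are infinitely
many irreducible admissible non-isomorphic quotients of the representations `π(σ, 0)` … such that
any `π` as in Theorem 3.4 is irreducible and is not a subquotient of a principal series (see [16]
when `k_F` is not `𝔽_p`)"), read with the survey's convention "irreducible always means
absolutely irreducible" (§1 p. 206) by taking coefficients in `𝔽̄_p` as the primary source [16]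
= Breuil–Paškūnas does; quotients of one `π(σ, 0) = c-Ind_{GL₂(𝒪_F)F^×}^{GL₂(F)} σ/(T)` share
the central character of the Serre weight `σ`.  It differs from `ModPLanglandsGL2BeyondQp` below
ONLY in the coefficient field (there: every sufficiently large finite `k`, irreducibility over
`k`), which is the discrepancy explained in the section docstring: over a finite `k` the old
conclusion is met by restrictions of scalars of principal series, even for `F = ℚ_p`.
Asserted for all such `F` in [Breuil2011, §3.2]; proved in print for `p > 3` and every such `F`,
ramified or not [Sheth2022, Thm. 3.2 and Cor. 3.3], and for `p > 2`, `F` unramified over `ℚ_p`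
(`BreuilPaskunas2012_supersingularFamily`, [BreuilPaskunas2012, Thms. 19.8, 19.10]); for `p = 2`,
and for `p = 3` with `F` ramified, no proof is printed (see the audit section).  Not proved here
(SIZE XL; bad-split review 2026-08-15: apex statement, keep as a named fact). [cite: Breuil2011, §3.2]
[cite: Sheth2022, Thm. 3.2 and Cor. 3.3]

BARRIER (structured block, D-0021):
- technique_class: p-adic-local-langlands mod-p-local-langlands breuil-mezard colmez-functor completed-cohomology
- blocks: extending the `GL₂/ℚ` proof of Fontaine–Mazur in arbitrary regular weight and level at `p` (Kisin: modularity lifting ⇔ Breuil–Mézard equality, proved via the `p`-adic local Langlands correspondence for `GL₂(ℚ_p)`; scope as printed "any totally real field in which `p` splits completely") to automorphy lifting for `GL₂` over totally real or CM `F` at places `v ∣ p` with `F_v ≠ ℚ_p`, and to `GL_n`, `n ≥ 3`, by the same local input [cite: Kisin2009, Introduction] [cite: CaraianiEtAl2016, §1]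
- because: for `F ≠ ℚ_p` the objects that a correspondence would have to match to the finitely many `ρ̄ : Gal(F̄/F) → GL₂(𝔽̄_p)` with given invariants are far more numerous — infinitely many pairwise non-isomorphic irreducible admissible supersingular `𝔽̄_p`-representations with a common central character (`ModPLanglandsGL2BeyondQpFpBar`; for `F` unramified `BreuilPaskunas2012_supersingularFamily`), against finitely many for `F = ℚ_p` [cite: Breuil2011, §1 and §2.1], universal modules `π(σ, 0)` of infinite length and not admissible (Thm. 3.3), correspondingly "too many" unitary Banach representations (Thm. 3.12), so "there is no possible naive `1 − 1` correspondence as for the `F = ℚ_p` case" and "the classification … remains thus unsettled" [cite: Breuil2011, §1 and §3]; a local correspondence "is only known for `GL₁(F)` … and for `GL₂(ℚ_p)`" [cite: CaraianiEtAl2016, §1]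
- evasions_known: (i) avoid arbitrary weight: automorphy lifting at `v ∣ p` with `F_v ≠ ℚ_p` for potentially Barsotti–Tate, Fontaine–Laffaille, ordinary or potentially diagonalisable local conditions, where the local deformation rings are controlled without a local correspondence — e.g. the Fontaine–Laffaille and ordinary theorems over CM fields [cite: ACCGHLNSTT2023, §1] and the potentially-Barsotti–Tate/ordinary hypotheses of [cite: CalegariGeraghty2017, §1 Thm. 1.1]; (ii) global-to-local: Taylor–Wiles–Kisin patching produces a candidate `V(r)` for `GL_n(F)` and proves many cases of the Breuil–Schneider conjecture, reducing the general case to automorphy lifting conjectures, but its independence of the global choices (hence a genuine local correspondence) is not proved [cite: CaraianiEtAl2016, §1]; (iii) partial structure for `GL₂(F)`, `F` unramified, generic `ρ̄`: the diagrams `D₀(ρ̄)` and families `Π(ρ̄)` of Breuil–Paškūnas [cite: Breuil2011, §3.2 Thm. 3.5]; none published giving a classification or a correspondence for any `F ≠ ℚ_p` [cite: Breuil2011, §3.2]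
- scope_caveats: the sources assert the failure of the *naive* extension and the absence of a known correspondence, not the impossibility of some local correspondence for `GL₂(F)` ("it would perhaps be premature to conjecture that it should" be purely local) [cite: CaraianiEtAl2016, §1]; coefficients are `𝔽̄_p` (irreducible = absolutely irreducible), not a finite field [cite: Breuil2011, §1]; stated for `#k_F > p` only, nothing for totally ramified `F` with `k_F = 𝔽_p` [cite: Breuil2011, §3.2]; PROVED in print for `p > 3` and every `F` with `f ≥ 2`, ramified or not ("a new result … for `F` ramified over `ℚ_p`") [cite: Sheth2022, Thm. 3.2 and Cor. 3.3] and for `p > 2`, `F` unramified (`BreuilPaskunas2012_supersingularFamily`) [cite: BreuilPaskunas2012, Thm. 19.8 and Thm. 19.10]; NOT proved in print for `p = 2`, nor for `p = 3` with `F` ramified — there the statement rests on the survey sentence ("see [16] when `k_F` is not `𝔽_p`") alone [cite: Breuil2011, §3.2], Sheth's cyclic modules needing a weight with `1 ≤ r_i ≤ p - 3` [cite: Sheth2022, Thm. 1.6] and the memoir's generic `ρ̄` needing `p ≥ 3` and `F = ℚ_{p^f}`, its irreducibility argument being one the authors "suspect … breaks down when `F` is ramified over `ℚ_p`" [cite: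 BreuilPaskunas2012, §1]; other printed ramified constructions: Schein's families with Serre-predicted `K`-socle for `k_F = 𝔽_{p²}`, `e ≤ (p-1)/2` and generic `ρ` [cite: Schein2022, Thm. 1.1], and Paškūnas' construction for arbitrary `F` of (at least) `q(q-1)/2` pairwise non-isomorphic supersingular representations with `ϖ` acting trivially, finitely many [cite: Paskunas2004, Thm. 6.25]
- status: established [cite: Breuil2011, §3.2] [cite: Sheth2022, Thm. 3.2 and Cor. 3.3] [cite: BreuilPaskunas2012, Thm. 19.8 and Thm. 19.10] -/
def ModPLanglandsGL2BeyondQpFpBar : Prop :=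
  ∀ (p : ℕ) [Fact p.Prime] (F : Type) [Field F] [ValuativeRel F] [TopologicalSpace F]
      [IsNonarchimedeanLocalField F],
    CharZero F → CharP 𝓀[F] p → p < Nat.card 𝓀[F] →
  ∀ (k : Type) [Field k] [Algebra (ZMod p) k] [IsAlgClosure (ZMod p) k],
    ∃ (V : ℕ → Type) (_ : ∀ i, AddCommGroup (V i)) (_ : ∀ i, Module k (V i))
      (π : ∀ i, Representation k (GL (Fin 2) F) (V i)),
      (∀ i, (π i).IsAdmissible ∧ (π i).IsIrreducible) ∧
      (∀ i j, i ≠ j → IsEmpty ((π i).Equiv (π j))) ∧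
      (∃ ω : Subgroup.center (GL (Fin 2) F) →* kˣ, ∀ i, (π i).HasCentralCharacter ω) ∧
      (∀ i, ¬ IsSubquotientOfPrincipalSeries (π i))

/-- **Breuil–Paškūnas: infinitely many supersingular representations of `GL₂(ℚ_{p^f})`,
`f ≥ 2`.**  Let `p > 2` be prime and `F` a non-archimedean local field of characteristic `0`
with residue field of characteristic `p` having more than `p` elements, UNRAMIFIED over `ℚ_p`
(i.e. `p` is a uniformizer: `𝓂[F] = (p)`, the memoir's standing choice "`ϖ` of `𝒪_F` which is
`p` when `F` is unramified over `ℚ_p` (so `𝔭_F = ϖ𝒪_F)`", §1 p. 12), so that `F = ℚ_{p^f}` with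
`f ≥ 2`; let `k` be an algebraic closure of `𝔽_p`.  Then there is a sequence of smooth
admissible irreducible `k`-representations of `GL₂(F)`, pairwise non-isomorphic, with a common
central character, none a subquotient of a principal series.  Printed proof (all references to
the memoir): a generic irreducible `ρ : Gal(ℚ̄_p/ℚ_{p^f}) → GL₂(𝔽̄_p)` exists for `p ≥ 3`
(Def. 11.7 and the lines after it), may be twisted so that `p` acts trivially on `det ρ` (§1
p. 7); the family of basic `0`-diagrams `D(ρ, r)` of §13 (Def. 13.7, Thm. 13.8) "is always
infinite" when `f > 1` (§13 p. 75, §1 p. 7); Thm. 19.8 (i) gives for each `D(ρ, r)` a smooth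
admissible `π ⊇ D(ρ, r)` with `soc_K π = ⊕_{σ∈𝒟(ρ)} σ` generated by `D₀(ρ)`, Thm. 19.8 (ii) makes
the `π` for non-isomorphic diagrams non-isomorphic, Thm. 19.10 (i) makes every such `π`
"irreducible and … a supersingular representation" (supersingular in the sense of Barthel–Livné,
[4] of the memoir), and all of them have "fixed central character (matching `det(ρ)` via local
class field theory)" (§1 p. 3).  Supersingular irreducible admissible representations over an
algebraically closed field are exactly the supercuspidal ones — not a subquotient of `Ind_B^G σ`
for an irreducible admissible (here: one-dimensional, i.e. a smooth character) `σ` of the torus —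
[cite: AbeEtAl2016, Thm. 5] ("For `G = GL₂` this was discovered by Barthel and
Livné", loc. cit. §I.5); this is `¬ IsSubquotientOfPrincipalSeries`.  Scope: the
memoir's §§11–19 assume `F` unramified ("From now on … we assume `F = ℚ_{p^f}`", §11 p. 65) and
`p > 2` (§19 p. 108: "Since there are no generic `ρ` if `p = 2` … we can assume `p > 2`").  Not
proved here (SIZE XL). [cite: BreuilPaskunas2012, Thm. 19.8 and Thm. 19.10]

BARRIER (structured block, D-0021):
- technique_class: p-adic-local-langlands mod-p-local-langlands breuil-mezard colmez-functor completed-cohomology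
- blocks: extending the `GL₂/ℚ` proof of Fontaine–Mazur in arbitrary regular weight and level at `p` (Kisin: modularity lifting ⇔ Breuil–Mézard equality via the `p`-adic local Langlands correspondence for `GL₂(ℚ_p)`, "any totally real field in which `p` splits completely") by the same local input to places `v ∣ p` with `F_v` unramified over `ℚ_p` of degree `≥ 2` (general `F_v` with `#k_{F_v} > p`: `ModPLanglandsGL2BeyondQpFpBar`) [cite: Kisin2009, Introduction] [cite: CaraianiEtAl2016, §1]
- because: for `F = ℚ_{p^f}`, `f ≥ 2`, `p > 2`, already ONE generic irreducible `ρ̄` carries an infinite family of pairwise non-isomorphic irreducible admissible supersingular `𝔽̄_p`-representations with `GL₂(𝒪_F)`-socle `⊕_{σ ∈ 𝒟(ρ̄)} σ` and central character matching `det ρ̄` (`BreuilPaskunas2012_supersingularFamily`: Thm. 19.8 (i)–(ii), Thm. 19.10 (i), the family `D(ρ̄, r)` being infinite for `f > 1`, §13), whereas for `F = ℚ_p` the basic `0`-diagram `D(ρ̄, r)` determines `π(ρ̄, r)` [cite: BreuilPaskunas2012, Thm. 1.6] and the supersingular representations, finitely many for each central character, correspond to the irreducible `ρ̄` [cite: Breuil2011,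 §2.1]; hence "when `f > 1`, this is not possible anymore as the family becomes much too big. It is then not clear so far how to formulate a correct 'modulo `p` local Langlands correspondence'" [cite: BreuilPaskunas2012, §1]
- evasions_known: (i) avoid arbitrary weight (potentially Barsotti–Tate, Fontaine–Laffaille, ordinary, potentially diagonalisable local conditions) [cite: ACCGHLNSTT2023, §1] [cite: CalegariGeraghty2017, §1 Thm. 1.1]; (ii) patched candidates `V(r)` for `GL_n(F)`, locality unproved [cite: CaraianiEtAl2016, §1]; (iii) cut the family down: consider only the `π` with `(π^{K₁}, π^{I₁}, can) ≅ D(ρ̄, r)`, or impose the `(φ, Γ)`-module condition of Breuil's [8] — "probably still not enough to select, e.g., a finite subset" [cite: BreuilPaskunas2012, §1]; none published giving a correspondence for `F ≠ ℚ_p` [cite: Breuil2011, §3.2]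
- scope_caveats: `F` unramified over `ℚ_p` with `f ≥ 2` and `p > 2` only (§11: "From now on … we assume `F = ℚ_{p^f}`"; §19: no generic `ρ̄` for `p = 2`) [cite: BreuilPaskunas2012, Thm. 19.8 and Thm. 19.10]; coefficients `𝔽̄_p`: the infinitude is that of the parameters `r` up to isomorphism, which live over `𝔽̄_p` — over a fixed finite field only finitely many `D(ρ̄, r)` are defined [cite: BreuilPaskunas2012, §13]; nothing is asserted here for ramified `F` (the authors "suspect that the argument … breaks down when `F` is ramified") [cite: BreuilPaskunas2012, §1] nor for `F = ℚ_p`, where the supersingular representations with a given central character are finitely many [cite: Breuil2011, §2.1]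
- status: established [cite: BreuilPaskunas2012, Thm. 19.8 and Thm. 19.10] -/
def BreuilPaskunas2012_supersingularFamily : Prop :=
  ∀ (p : ℕ) [Fact p.Prime], p ≠ 2 →
  ∀ (F : Type) [Field F] [ValuativeRel F] [TopologicalSpace F] [IsNonarchimedeanLocalField F],
    CharZero F → CharP 𝓀[F] p → p < Nat.card 𝓀[F] →
    𝓂[F] = Ideal.span {(p : 𝒪[F])} →
  ∀ (k : Type) [Field k] [Algebra (ZMod p) k] [IsAlgClosure (ZMod p) k],
    ∃ (V : ℕ → Type) (_ : ∀ i, AddCommGroup (V i)) (_ : ∀ i, Module k (V i))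
      (π : ∀ i, Representation k (GL (Fin 2) F) (V i)),
      (∀ i, (π i).IsAdmissible ∧ (π i).IsIrreducible) ∧
      (∀ i j, i ≠ j → IsEmpty ((π i).Equiv (π j))) ∧
      (∃ ω : Subgroup.center (GL (Fin 2) F) →* kˣ, ∀ i, (π i).HasCentralCharacter ω) ∧
      (∀ i, ¬ IsSubquotientOfPrincipalSeries (π i))

/-- The Breuil–Paškūnas theorem (`F` unramified, `p > 2`) is the special case of the survey claim
`ModPLanglandsGL2BeyondQpFpBar` (all `F` with `#k_F > p`) in which a complete proof is printed:
the implication is the specialisation of the hypotheses. [folklore] -/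
theorem BreuilPaskunas2012_supersingularFamily.of_fpBar (h : ModPLanglandsGL2BeyondQpFpBar) :
    BreuilPaskunas2012_supersingularFamily :=
  fun p _ _ F _ _ _ _ hF hp hq _ k _ _ _ => h p F hF hp hq k

end Corrected

/-! ## The original rendering (MIS-STATED — deprecated 2026-08-15; tombstone, kept verbatim for the record)

Not a barrier entry and not a named fact awaiting discharge: the catalogued statement is
`ModPLanglandsGL2BeyondQpFpBar` above (with `BreuilPaskunas2012_supersingularFamily`), whose
docstrings carry the structured D-0021 block.  This section only keeps the superseded constant.
-/

/-- **DEPRECATED — MIS-STATED rendering (coefficient convention) of Breuil's ICM survey, §3.2;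
provefact audit and verdict clean-up, 2026-08-15.  Use `ModPLanglandsGL2BeyondQpFpBar` (the
printed statement: same hypotheses and conclusion, coefficients an algebraic closure of `𝔽_p`) or
`BreuilPaskunas2012_supersingularFamily` (the case proved in print, `F` unramified, `p > 2`).**
Printed (Breuil, Proc. ICM 2010, Vol. II, §3.2, p. 218): "These examples are enough to show that
there are infinitely many irreducible admissible non-isomorphic quotients of the representations
`π(σ, 0)`, for instance because there are infinitely many `D₀` containing `σ` for which there
exist many non-isomorphic compatible actions of `N(F)` on `D₀^{I₁}` such that any `π` as in
Theorem 3.4 is irreducible and is not a subquotient of a principal series (see [16] when `k_F` is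
not `𝔽_p`)", under the standing convention of §1, p. 206: "Representations always take values …
in `k_E`-vector spaces where `E` is always a 'sufficiently big' finite extension of `ℚ_p` … For
instance irreducible always means absolutely irreducible"; and §1, p. 204: "(i) there are
infinitely many smooth irreducible (admissible) representations of `GL₂(F)` over any finite field
containing the residue field of `F` (whereas when `F = ℚ_p` there is only a finite number of
them)".  This declaration rendered it as: for a prime `p` and a non-archimedean local field `F` of
characteristic `0` with residue field of characteristic `p` and more than `p` elements, there is a
finite field `k₀` of characteristic `p` such that over every finite field `k` of characteristic
`p` receiving `k₀` there is a sequence of admissible, irreducible `k`-representations of `GL₂(F)`,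
pairwise non-isomorphic, with a common central character, none a subquotient of a principal
series `Ind_{B(F)}^{GL₂(F)} χ` with `χ` a smooth `k`-valued character of `B(F)`
(`IsSubquotientOfPrincipalSeries`).
**What is wrong with it.** The convention "irreducible = absolutely irreducible" was dropped:
`Representation.IsIrreducible` is `IsSimpleOrder (Subrepresentation π)`, irreducibility over the
finite field `k` itself, and `IsSubquotientOfPrincipalSeries` tests only `k`-valued `χ`.  With
these two readings the conclusion is met for EVERY such `F` (and equally for `F = ℚ_p`, where the
survey prints that there are only finitely many) by representations that have nothing to do
with supersingular ones: for `k'/k` of degree `d ≥ 2` and an unramified character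
`χ : F^× → k'^×` with `k(χ(ϖ)) = k'` and `χ² ≠ 1`, the restriction of scalars
`Res_{k'/k} Ind_{B(F)}^{GL₂(F)}(χ ⊗ χ⁻¹)` is smooth, admissible and irreducible over `k`, has
trivial central character and a `d`-dimensional space of `GL₂(𝒪_F)`-invariants (so distinct `d`
give non-isomorphic representations), and is not a subquotient of any `k`-valued principal
series; see the section "Audit of the coefficient convention" above for the argument and its
sources (the classification of the subquotients of principal series, Barthel–Livné, as the case
`GL₂` of Abe–Henniart–Herzig–Vignéras, Thms. 1–3).  Hence this `Prop` holds, granted those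
classification theorems, for reasons orthogonal to the barrier; it does not separate `F = ℚ_p`
from `F ≠ ℚ_p`, it is not the printed abundance statement, and discharging it would establish
nothing about the barrier (verdict of its tenured prove seat, re-verified at the clean-up with
the sources open).
**Corrected statements:** `ModPLanglandsGL2BeyondQpFpBar` (the survey claim read with its
convention, coefficients `𝔽̄_p` as in the primary source, Breuil–Paškūnas, §1 p. 12: "All
representations are over `𝔽̄_p`-vector spaces"; asserted for all `F` with `#k_F > p`, proved in
print for `p > 3` by Sheth and for `p > 2`, `F` unramified, by Breuil–Paškūnas) and
`BreuilPaskunas2012_supersingularFamily` (the memoir's theorem), both above, each with the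
structured D-0021 barrier block; this tombstone deliberately carries none, so that the barrier
catalogue of the summit lists live statements only.  The statement below is unchanged (body byte
for byte as first vendored), kept under its name as the literal record by the human ruling of
2026-08-15 on mis-stated facts (restate under a new name, deprecate, do not delete); no module
imports this file for it and no Lean term names it (checked 2026-08-15).  Never take
`(h : ModPLanglandsGL2BeyondQp)` as a hypothesis and do not try to discharge it: every use of the
name raises a deprecation warning pointing at the corrected fact.
[cite: Breuil2011, §3.2 (p. 218) with §1 (pp. 204, 206) as mis-rendered over a finite coefficient field (see the deprecation note); corrected as ModPLanglandsGL2BeyondQpFpBar] -/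
@[deprecated ModPLanglandsGL2BeyondQpFpBar "mis-stated (irreducibility over a finite field k and \
  k-valued principal series only, which restrictions of scalars of principal series satisfy for \
  every F, Q_p included); use Literature.Barriers.Langlands.ModPLanglandsGL2BeyondQpFpBar (the \
  printed statement, coefficients an algebraic closure of F_p) or \
  Literature.Barriers.Langlands.BreuilPaskunas2012_supersingularFamily (the case proved in print)"
  (since := "2026-08-15")]
def ModPLanglandsGL2BeyondQp : Prop :=
  ∀ (p : ℕ) [Fact p.Prime] (F : Type) [Field F] [ValuativeRel F] [TopologicalSpace F] [IsNonarchimedeanLocalField F],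
    CharZero F → CharP 𝓀[F] p → p < Nat.card 𝓀[F] →
  ∃ (k₀ : Type) (_ : Field k₀) (_ : Fintype k₀), CharP k₀ p ∧
  ∀ (k : Type) [Field k] [Fintype k], CharP k p → Nonempty (k₀ →+* k) →
    ∃ (V : ℕ → Type) (_ : ∀ i, AddCommGroup (V i)) (_ : ∀ i, Module k (V i))
      (π : ∀ i, Representation k (GL (Fin 2) F) (V i)),
      (∀ i, (π i).IsAdmissible ∧ (π i).IsIrreducible) ∧
      (∀ i j, i ≠ j → IsEmpty ((π i).Equiv (π j))) ∧
      (∃ ω : Subgroup.center (GL (Fin 2) F) →* kˣ, ∀ i, (π i).HasCentralCharacter ω) ∧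
      (∀ i, ¬ IsSubquotientOfPrincipalSeries (π i))

end Literature.Barriers.Langlands
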